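import Literature.IUT.HodgeTheaters.PMBaseProcessionsProofs
import Literature.IUT.HodgeTheaters.Processions

/-!
# [IUTchI] Proposition 6.9 in the vocabulary of Definition 4.10: `Prc(†𝔇_T)`, `Prc(†𝔇^⊢_T)`, `Prc(†𝔇_{T^⋇})` as processions, and the inclusion of Proposition 6.9 (iii)

Mochizuki, *Inter-universal Teichmüller theory I*, §6, Proposition 6.9 (i)–(iii) pp. 169–170 (and §4,
Definition 4.10 p. 119, Proposition 4.11 (i) p. 120), kurims manuscript (May 2020). MERGE file by the
wave-4 discharge seat abc-iut-w4-d076 (DAG nodes IUTchI:Prop6.9(i), (ii), (iii)): abc-iut-L5-t4's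
`PMBaseProcessions.lean` typed the processions of Prop 6.9 as bare families of capsules
(`DThetaPMBridge.procession`, `monoProcession`), with "processions = [IUTchI] Def 4.10 p. 119,
TODO-merge:abc-iut-L5-t3"; abc-iut-L5-t3's `Processions.lean` (Def 4.10 `Procession`, `Procession.Hom`,
`Procession.map`; Prop 4.11 (i) `DThetaBridge.prc`) has since landed. Here the TODO-merge is resolved:

* Prop 6.9 (i): `Prc(†𝔇_T)` — "the `l^±`-procession of `𝒟`-prime-strips determined by considering the
  [sub]capsules of the capsule `†𝔇_{|T|}` corresponding to the subsets `S^±_1 ⊆ … ⊆ S^±_t := {0, 1, …, t−1}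
  ⊆ … ⊆ S^±_{l^±} = |𝔽_l|`, relative to the bijection `|T| ⥲ |𝔽_l|`" — as an honest `l^±`-procession of
  Def 4.10 (`DThetaPMBridge.prc : Procession K.DStrip l^±`): its `t`-capsule IS a `t`-capsule (index set of
  cardinality exactly `t`, by `card_procession_idx` of `PMBaseProcessionsProofs.lean`) with constituents
  those of t4's `procession t` (`prc_obj`);
* Prop 6.9 (ii): `Prc(†𝔇^⊢_T)` := the image of `Prc(†𝔇_T)` under mono-analyticization, via Def 4.10's
  `Procession.map` (`prcMono`), with constituents t4's `monoProcession` (`prcMono_obj`);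
* Prop 4.11 (i) applied to the `𝒟-Θ`-bridge `†φ^Θ_⋆ : †𝔇_{T^⋇} → †𝔇_>` of Prop 6.7: `Prc(†𝔇_{T^⋇})`, the
  `l^⋇`-procession by the subsets `S^⋇_1 ⊆ … ⊆ S^⋇_j = {1, …, j} ⊆ … ⊆ S^⋇_{l^⋇}` relative to the labelling
  `T^⋇ ⥲ 𝔽_l^⋇` induced by the `𝔽_l^±`-group structure (`prcStar : Procession K.DStrip l^⋇`, `lStar l =
  (l−1)/2` of `Labels.lean`), and its mono-analyticization (`prcStarMono`);
* Prop 6.9 (iii): "the natural inclusions `S^⋇_j = {1, …, j} ↪ S^±_t = {0, 1, …, t−1}` — where `j ∈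
  {1, …, l^⋇}` and `t := j + 1` — determine natural transformations
  `†φ^{Θ±}_± ↦ (Prc(†𝔇_{T^⋇}) ↪ Prc(†𝔇_T))`, `†φ^{Θ±}_± ↦ (Prc(†𝔇^⊢_{T^⋇}) ↪ Prc(†𝔇^⊢_T))`" — as MORPHISMS OF
  PROCESSIONS in the sense of Def 4.10 (`prcInclusion`, `prcMonoInclusion`: the order-preserving
  injection `j ↦ j + 1` of `{1, …, l^⋇}` into `{1, …, l^±}` with the inclusions of index sets), whose
  constituent capsule-full poly-morphisms are between literally equal `𝒟`-prime-strips (`prcInclusion_obj`,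
  `prcMonoInclusion_obj`) — the content of t4's named statement `ProcessionCompat`, discharged in
  `PMBaseProcessionsProofs.lean` (`processionCompat_thetaBridgeData`).

Throughout `l` is odd ([IUTchI] Def 3.1 (c): `l ≥ 5` prime). Record only; [claim: Mochizuki2012,
status: disputed]; nothing here takes a side on any disputed step.
-/

namespace Literature.IUT.HodgeTheaters

open CategoryTheory

universe u

namespace PMBaseKit

variable {l : ℕ} {K : PMBaseKit.{u} l}

namespace DThetaPMBridge

variable (B : K.DThetaPMBridge)

/-! ### Proposition 6.9 (i): `Prc(†𝔇_T)` as an `l^±`-procession (Definition 4.10) -/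

/-- **Prop 6.9 (i)** ([IUTchI] p. 169), `Prc(†𝔇_T)` as an `l^±`-procession of `𝒟`-prime-strips in the sense
of Def 4.10 ([IUTchI] p. 119, abc-iut-L5-t3's `Procession`): for `t = 1, …, l^±` (0-indexed by
`n = t − 1 : Fin l^±`) the `t`-capsule is the sub-capsule of `†𝔇_{|T|}` on the classes with label in
`S^±_t = {0, 1, …, t − 1}` — an index set of cardinality exactly `t` (`card_procession_idx`). For `l` odd.
[claim: Mochizuki2012, status: disputed] -/
noncomputable def prc (hl : Odd l) : Procession K.DStrip ((l + 1) / 2) where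
  idx n := {q : B.grpT.Abs // B.absLabel q < (n : ℕ) + 1}
  finite_idx n := Nat.finite_of_card_ne_zero (by
    rw [B.card_procession_idx hl (n := (n : ℕ) + 1) (by have := n.2; omega)]
    exact Nat.succ_ne_zero _)
  card_idx n := B.card_procession_idx hl (by have := n.2; omega)
  obj n q := B.procession ((n : ℕ) + 1) q

/-- The constituents of the `t`-capsule of `Prc(†𝔇_T)` are those of abc-iut-L5-t4's `procession t`, i.e. the
`†𝔇_{|t|}` with `label(|t|) < t` ([IUTchI] Prop 6.9 (i) p. 169). [claim: Mochizuki2012, status: disputed] -/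
theorem prc_obj (hl : Odd l) (n : Fin ((l + 1) / 2)) (q : {q : B.grpT.Abs // B.absLabel q < (n : ℕ) + 1}) :
    (B.prc hl).obj n q = B.procession ((n : ℕ) + 1) q := rfl

/-- The index sets of `Prc(†𝔇_T)` are nested along `S^±_t ⊆ S^±_{t'}` for `t ≤ t'`, with literally equal
constituents (the arrows `P_t ↪ P_{t+1}` of Def 4.10 carry no further data) ([IUTchI] Prop 6.9 (i)
p. 169). [claim: Mochizuki2012, status: disputed] -/
theorem prc_obj_incl (hl : Odd l) {n n' : Fin ((l + 1) / 2)} (h : n ≤ n')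
    (q : {q : B.grpT.Abs // B.absLabel q < (n : ℕ) + 1}) :
    (B.prc hl).obj n' (B.processionIncl (Nat.succ_le_succ h) q) = (B.prc hl).obj n q := rfl

/-! ### Proposition 6.9 (ii): `Prc(†𝔇^⊢_T)` -/

/-- **Prop 6.9 (ii)** ([IUTchI] pp. 169–170), `Prc(†𝔇^⊢_T)`: "by composing the functor of (i) with the
mono-analyticization operation" — the image of the procession `Prc(†𝔇_T)` under `†𝔇 ↦ †𝔇^⊢` (Def 4.10's
`Procession.map`), an `l^±`-procession of `𝒟^⊢`-prime-strips with the same index sets ("the same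
indeterminacy properties with respect to labels"). For `l` odd. [claim: Mochizuki2012, status: disputed] -/
noncomputable def prcMono (M : K.MultKit) (hl : Odd l) : Procession M.DMono ((l + 1) / 2) :=
  (B.prc hl).map M.mono

/-- The constituents of `Prc(†𝔇^⊢_T)` are those of abc-iut-L5-t4's `monoProcession` ([IUTchI] Prop 6.9 (ii)
p. 169). [claim: Mochizuki2012, status: disputed] -/
theorem prcMono_obj (M : K.MultKit) (hl : Odd l) (n : Fin ((l + 1) / 2))
    (q : {q : B.grpT.Abs // B.absLabel q < (n : ℕ) + 1}) :
    (B.prcMono M hl).obj n q = B.monoProcession M ((n : ℕ) + 1) q := rfl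

/-! ### Proposition 4.11 (i) applied to the `𝒟-Θ`-bridge of Proposition 6.7: `Prc(†𝔇_{T^⋇})` -/

/-- `Prc(†𝔇_{T^⋇})`: the `l^⋇`-procession of `𝒟`-prime-strips of Prop 4.11 (i) ([IUTchI] p. 120: "the
[sub]capsules of `†𝒟_J` corresponding to the subsets `S^⋇_1 ⊆ … ⊆ S^⋇_j := {1, 2, …, j} ⊆ … ⊆ S^⋇_{l^⋇}
:= 𝔽_l^⋇`, relative to the bijection `†χ : J ⥲ 𝔽_l^⋇`") for the `𝒟-Θ`-bridge `†φ^Θ_⋆ : †𝔇_{T^⋇} → †𝔇_>`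
produced by the functorial algorithm of Prop 6.7 (t4's `thetaBridgeData`, whose labelling `T^⋇ ⥲ 𝔽_l^⋇`
is the one induced by the `𝔽_l^±`-group structure of `T`, [IUTchI] Prop 6.9 (iii) p. 170): the
`j`-capsule (0-indexed by `j − 1 : Fin l^⋇`) is indexed by the classes of label `≤ j`, a set of
cardinality exactly `j` (`card_starProcession_idx`). For `l` odd. [claim: Mochizuki2012, status: disputed] -/
noncomputable def prcStar (M : K.MultKit) (hl : Odd l) : Procession K.DStrip (lStar l) where
  idx j := {q : B.grpT.AbsStar // B.absLabel q.1 ≤ (j : ℕ) + 1}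
  finite_idx j := Nat.finite_of_card_ne_zero (by
    rw [B.card_starProcession_idx hl (j := (j : ℕ) + 1) (by have := j.2; unfold lStar at this; omega)]
    exact Nat.succ_ne_zero _)
  card_idx j := B.card_starProcession_idx hl (by have := j.2; unfold lStar at this; omega)
  obj _ q := (B.thetaBridgeData M hl).capsule ⟨q.1⟩

/-- The constituents of `Prc(†𝔇_{T^⋇})` are the constituents `†𝔇_q`, `q ∈ T^⋇`, of the capsule of the
`𝒟-Θ`-bridge of Prop 6.7 ([IUTchI] Prop 4.11 (i) p. 120). [claim: Mochizuki2012, status: disputed] -/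
theorem prcStar_obj (M : K.MultKit) (hl : Odd l) (j : Fin (lStar l))
    (q : {q : B.grpT.AbsStar // B.absLabel q.1 ≤ (j : ℕ) + 1}) :
    (B.prcStar M hl).obj j q = (B.thetaBridgeData M hl).capsule ⟨q.1⟩ := rfl

/-- `Prc(†𝔇^⊢_{T^⋇})`: Prop 4.11 (ii) ([IUTchI] pp. 120–121, "composing the functor of (i) with the
mono-analyticization operation") for the `𝒟-Θ`-bridge of Prop 6.7. For `l` odd.
[claim: Mochizuki2012, status: disputed] -/
noncomputable def prcStarMono (M : K.MultKit) (hl : Odd l) : Procession M.DMono (lStar l) :=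
  (B.prcStar M hl).map M.mono

/-! ### Proposition 6.9 (iii): the inclusions `Prc(†𝔇_{T^⋇}) ↪ Prc(†𝔇_T)`, `Prc(†𝔇^⊢_{T^⋇}) ↪ Prc(†𝔇^⊢_T)` -/

/-- For `l` odd, `l^⋇ + 1 = l^±`: `(l − 1)/2 + 1 = (l + 1)/2` ([IUTchI] Def 6.1 (i) p. 155, §0).
[claim: Mochizuki2012, status: disputed] -/
theorem lStar_add_one (hl : Odd l) : lStar l + 1 = (l + 1) / 2 := by
  obtain ⟨k, hk⟩ := hl; unfold lStar; omega

/-- The order-preserving injection `{1, …, l^⋇} ↪ {1, …, l^±}`, `j ↦ t := j + 1` ([IUTchI] Prop 6.9 (iii)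
p. 170), 0-indexed. For `l` odd. [claim: Mochizuki2012, status: disputed] -/
def succIota (hl : Odd l) : Fin (lStar l) ↪o Fin ((l + 1) / 2) :=
  OrderEmbedding.ofStrictMono (fun j => ⟨(j : ℕ) + 1, by have := j.2; have := lStar_add_one hl; omega⟩)
    fun a b h => by rw [Fin.mk_lt_mk]; exact Nat.succ_lt_succ h

/-- `succIota j = j + 1` on underlying naturals. [claim: Mochizuki2012, status: disputed] -/
@[simp] theorem succIota_val (hl : Odd l) (j : Fin (lStar l)) : (succIota hl j : ℕ) = (j : ℕ) + 1 := rfl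

/-- **Prop 6.9 (iii)** ([IUTchI] p. 170), holomorphic half, as a MORPHISM OF PROCESSIONS (Def 4.10): "the
natural inclusions `S^⋇_j = {1, …, j} ↪ S^±_t = {0, 1, …, t−1}` — where `j ∈ {1, …, l^⋇}` and `t := j+1` —
determine natural transformations `†φ^{Θ±}_± ↦ (Prc(†𝔇_{T^⋇}) ↪ Prc(†𝔇_T))`": the order-preserving injection
`j ↦ j + 1` together with, for each `j`, the inclusion of the index set of the `j`-capsule of
`Prc(†𝔇_{T^⋇})` (classes of label `∈ {1, …, j}`) into that of the `(j+1)`-capsule of `Prc(†𝔇_T)` (classes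
of label `∈ {0, …, j}`) — the injection of index sets underlying a capsule-full poly-morphism whose
constituents sit between EQUAL `𝒟`-prime-strips (`prcInclusion_obj`). For `l` odd.
[claim: Mochizuki2012, status: disputed] -/
noncomputable def prcInclusion (M : K.MultKit) (hl : Odd l) :
    Procession.Hom (B.prcStar M hl) (B.prc hl) where
  ι := succIota hl
  emb _ := ⟨fun q => ⟨q.1.1, Nat.lt_succ_of_le q.2⟩, fun q q' h => by
    have h2 := congrArg Subtype.val h
    dsimp only at h2
    exact Subtype.ext (Subtype.ext h2)⟩

/-- Prop 6.9 (iii), holomorphic half: along `prcInclusion` the constituents agree — the `𝒟`-prime-strip of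
`Prc(†𝔇_{T^⋇})` at `q ∈ T^⋇` in the `j`-capsule IS the `𝒟`-prime-strip of `Prc(†𝔇_T)` at `q` in the
`(j+1)`-capsule ([IUTchI] p. 170; = t4's `ProcessionCompat`, cf. `processionCompat_thetaBridgeData`).
[claim: Mochizuki2012, status: disputed] -/
theorem prcInclusion_obj (M : K.MultKit) (hl : Odd l) (j : Fin (lStar l))
    (q : {q : B.grpT.AbsStar // B.absLabel q.1 ≤ (j : ℕ) + 1}) :
    (B.prc hl).obj ((B.prcInclusion M hl).ι j) ((B.prcInclusion M hl).emb j q) =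
      (B.prcStar M hl).obj j q := rfl

/-- **Prop 6.9 (iii)** ([IUTchI] p. 170), mono-analytic half, as a morphism of processions:
`†φ^{Θ±}_± ↦ (Prc(†𝔇^⊢_{T^⋇}) ↪ Prc(†𝔇^⊢_T))`, the same injections of index sets. For `l` odd.
[claim: Mochizuki2012, status: disputed] -/
noncomputable def prcMonoInclusion (M : K.MultKit) (hl : Odd l) :
    Procession.Hom (B.prcStarMono M hl) (B.prcMono M hl) where
  ι := succIota hl
  emb _ := ⟨fun q => ⟨q.1.1, Nat.lt_succ_of_le q.2⟩, fun q q' h => by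
    have h2 := congrArg Subtype.val h
    dsimp only at h2
    exact Subtype.ext (Subtype.ext h2)⟩

/-- Prop 6.9 (iii), mono-analytic half: along `prcMonoInclusion` the constituent `𝒟^⊢`-prime-strips agree
([IUTchI] p. 170). [claim: Mochizuki2012, status: disputed] -/
theorem prcMonoInclusion_obj (M : K.MultKit) (hl : Odd l) (j : Fin (lStar l))
    (q : {q : B.grpT.AbsStar // B.absLabel q.1 ≤ (j : ℕ) + 1}) :
    (B.prcMono M hl).obj ((B.prcMonoInclusion M hl).ι j) ((B.prcMonoInclusion M hl).emb j q) =
      (B.prcStarMono M hl).obj j q := rfl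

end DThetaPMBridge

end PMBaseKit

end Literature.IUT.HodgeTheaters
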